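import Literature.MathematicalPhysics.QuantumFieldTheory.Balaban1983to89.B11Claim309UAnalytic
import Literature.MathematicalPhysics.QuantumFieldTheory.Balaban1983to89.Node00.BackgroundSelOfRecord

/-!
# N07 ∕ P0 — «[15] THEOREM 1 AS A NAMED MAP», THE KNIT (director-ym №509 (A), dag-lead g41 WORDS 634∕635 hand P0 (b)):
# the FIXED POINT of [15]'s contraction map (Prop. 6, `B11Prop6Scheme.mapT` ∕ `B11Eq174Chart.solA`) ⟹ the MINIMISER of record's shape
# (`IsBackground`: in the class, minimal over the class), UNIQUENESS OF THE MINIMAL ORBIT (`UniqueUkOrbit`'s shape), the SELECTOR IDENTIFICATION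
# «any rooted minimiser selector = rooted gauge of the chart image of the fixed point» (the law DEF-1's P0 (a) `Node00/BackgroundMapOfRecord` is to display),
# and ANALYTICITY of such a selector in every chart variable (via `B11Claim309UAnalytic.analyticOnNhd_solA`) — PART I: SCHEME LEVEL
# (generic over the variational carriers and [15]'s abstract Banach data; the record instantiation is PART II, appended when P0 (a)'s names land)

Cell `pub-ymgap` (YM-PLAN Track A, D-0062), width seat `pub-ymgap-dag-n07-w3` (g23; N07 = [15] = [Balaban1985Variational] lane).  `--kind proof --supports
stmt-QuantumFields-27930 --as helper` (port row ⁸ `PortRecordRepresentationS1`, whose `stub_LZ` (α) and hypotheses `hUk` ∕ `hBg` this serves), COUNT-NEUTRAL.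
NEW leaf; theorems only — 0 `def`, 0 `structure`, 0 `sorry`, 0 `instance`, 0 `notation`; standard axioms.  Imports lit [B11] `B11Claim309UAnalytic` (⊇ `B11Eq174Chart`
⊇ `B11Prop6Scheme` ⊇ `B13Contraction113`, `B8SectDSource`) and NODE 00's `Node00/BackgroundSelOfRecord` (`UkSel`, `rootGauge`, `IsBackground ∕ UkExists ∕ UniqueUkOrbit`, `OrbitRel`);
nothing there is edited; NO route file imported.  §1–§3 are record-free; §4 reads NODE 00's OBJECTS with the CHART kept abstract (a function `Φ` into `GaugeField (F.P K) 0 (SU N)`),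
so that DEF-1∕def-Y's P0 (a) `Node00/BackgroundMapOfRecord` only has to supply `Φ` := its chart image and the five tokens.
[15] = [Balaban1985Variational]; [I] = [Balaban1987RG1]; [6] = [Balaban1985RegularSpaces]; [5] = [Balaban1985BackgroundPropagators].

WHY (№509 (A); port-lead Q-22; dag-lead census WORDS 634).  Every consumer of NODE 00's background field — the port rows' `hUk : … UkExists ∧ UniqueUkOrbit` and
`hBg : AnalyticAt ℝ (B ↦ recordBgField …)`, the K0∕K1 texts' `VariationalThm1RegSepCoP7MGB`, road B's (H-U)∕(I19) rows — reads [15] Theorem 1 p. 279 as a HYPOTHESIS about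
`Node00.Uk ∕ UkSel` (a `Classical.choose` ∕ measurable CHOICE among minimisers; `Node00/BackgroundSelOfRecord` :20 «[B11] Thm 1 NOT used»), while the tree's [15] library
PROVES, over abstract complex Banach data, the map-level core of Theorem 1's proof: Prop. 6's contraction (`B11Prop6Scheme.existsUnique_solution`, `B11Eq174Chart.Regime.existsUnique ∕
solA_mem ∕ eq_solA`), the chart 𝓗 ((174), `chartH`), and «the fixed point of a uniformly contracting analytic family is analytic in the parameter» (`B11Claim309UAnalytic.analyticAt_fix`,
`analyticOnNhd_solA ∕ _chartH`).  What is NOT in the tree is the KNIT from «fixed point» to «minimiser of record ∕ unique orbit ∕ analytic selector».  This file types that knit ONCE,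
generically, so that (i) the record instantiation (Part II) is a substitution of DEF-1's P0 (a) names, and (ii) the EXACT list of [15]-leaves the record edition must display is
fixed BY THE KERNEL — they are the hypotheses of §1 that §2 does NOT discharge:
  (cov)  COVERAGE UP TO RESIDUAL GAUGE: every configuration of the class-∩-fibre `S` is residual-gauge equivalent to a chart point `Φ A`, `A ∈ K`
         — [15] pp. 280–281 (via [6] Thm 2) + Prop. 3 p. 289 + (113)–(114) p. 294 (`B11GlobalMin.ChartCovers` is its action-value shadow);
  (rng)  RANGE: chart points lie in `S` — (75)–(77) ⊆ (6) ∩ 𝔅_k(V), [15] p. 289, and the fibre clause `Q𝔊 = 0` ([15] p. 294; `B11Eq111FrakG.frakG_mem_constraint102`);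
  (c→s)  A CHART MINIMISER SOLVES (111)∕(116) IN THE BALL (115): interior criticality (82)∕(99) → (110) → (111) ([15] Sects. C–D pp. 289–294) + the a-priori smallness of Prop. 2
         p. 281 (a minimiser's Landau coordinate lies in (115));
  (min)  THE FIXED POINT MINIMISES ON THE CHART: (141)–(142) p. 299 (`B11Eq142LocalMin.isLocalMinOn_142`, local) + the located GLOBAL step (`B11GlobalMin.ChartConvex` — printed nowhere,
         cell D-B11-2 ∕ G-B11-E5g — or the one-norm `B11Eq142LocalMin.isMinOn_of_critical`);
  (inv)  residual-gauge invariance of the action ([I] (0.21) p. 256; tree `B12GaugeOrbits021.isBackground_gaugeAct`);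
and what §2 DOES discharge is Banach uniqueness∕existence in the ball (Prop. 6, PROVED) and §3 the analyticity of the solution (PROVED), given the `Regime` ((117)–(121)) and the
analyticity of the DATA `𝒢, Λ, W, J, 𝔄` — themselves [5] Thm 3.13 ∕ [15] Prop. 4 ∕ (103)-shaped hypotheses, exactly as in `B11Prop6Scheme` ∕ `B11Claim309UAnalytic`.

CONTENTS (all kernel-checked; generic types `Cfg` (configurations), `E` (chart space), class-∩-fibre `S : Set Cfg`, action `𝓐 : Cfg → ℝ`, residual orbit relation `orb`,
chart `Φ : E → Cfg` on `K : Set E`, a «solves-in-the-ball» predicate `IsSol : E → Prop`, a distinguished chart point `A⋆`).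
§1 THE KNIT (pure logic over the five tokens + uniqueness of ball solutions):
  `classMin_of_tokens` — (rng)(cov)(inv)(min) ⟹ `Φ A⋆ ∈ S ∧ ∀ U ∈ S, 𝓐 (Φ A⋆) ≤ 𝓐 U` (the two non-trivial clauses of `IsBackground`);
  `eq_star_of_isMinOn` — (c→s) + uniqueness + (min) ⟹ a chart minimiser IS `A⋆`;  `isMinOn_chart_of_isMin_class` — (rng)(inv) ⟹ a class minimiser's covering chart point is a chart minimiser;
  ★ `orb_star_of_isMin` — every class minimiser is residual-gauge equivalent to `Φ A⋆`;  ★★ `orb_of_isMin_of_isMin` — ANY TWO class minimisers lie on one orbit (`UniqueUkOrbit`'s shape);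
  ★★ `sel_eq_root_chart_star` — THE SELECTOR IDENTIFICATION: a minimiser `sel ∈ S` fixed by a rooted-gauge map `root` (`root sel = sel`) that is constant on orbits EQUALS `root (Φ A⋆)` —
  the law P0 (a) displays for `Node00.UkSel`, DERIVED from the tokens.
§2 THE SCHEME INSTANCE (E := [15]'s complex Banach space `𝒴`, `IsSol A := ‖A‖ ≤ ε₄ ∧ mapT 𝒢 Λ W J 𝔄 A = A`, `A⋆ := solA 𝒢 Λ W J ε₄ 𝔄`): under a `Regime` and the data bounds, ball
  solutions are unique and `solA` is one (`B11Eq174Chart`, PROVED) — `isSolBall_solA`, `isSolBall_unique`; hence ★★ `orb_of_isMin_of_isMin_scheme`, ★★ `sel_eq_root_chart_solA`,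
  `classMin_solA_of_tokens` with ONLY (cov)(rng)(c→s)(min)(inv) displayed.
§4 AT NODE 00's OBJECTS, CHART ABSTRACT (`Cfg := GaugeField (F.P K) 0 (SU N)`, `𝓐 := wilsonAction4`, `orb := OrbitRel k`, `S := bgReg F N K k ε ∩ {Ū^k = V}`, `root :=
  rootGauge k`, `sel := UkSel F N K k ε V`; (inv) and the orbit laws DISCHARGED by `B12GaugeOrbits021.wilsonAction4_eq_of_orbitRel` ∕ `OrbitRel.symm ∕ .trans`): ★★ `isBackground_chart_of_tokens`
  (⟹ `IsBackground (avOfRecord F N K) (bgReg F N K k ε) k V (Φ A⋆)` LITERALLY), `ukExists_chart_of_tokens`, ★★★ `uniqueUkOrbit_chart_of_tokens` (⟹ `UniqueUkOrbit F N K k ε V` LITERALLY —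
  the port rows' `hUk` second conjunct), ★★★ `ukSel_eq_rootGauge_chart_of_tokens` (⟹ `UkSel F N K k ε V = rootGauge k (Φ A⋆)` — №509 (A)'s NAMED MAP as an equation, `k ≤ m + K`),
  and the scheme instances `uniqueUkOrbit_chart_of_scheme` ∕ `ukSel_eq_rootGauge_chart_solA` with Prop. 6's uniqueness discharged.
§3 ANALYTICITY OF THE IDENTIFIED SELECTOR: for data depending analytically on a parameter `u ∈ 𝒪` (open) of a complex Banach space `𝒰` under a uniform `Regime`
  (`B11Claim309UAnalytic` §2's hypotheses verbatim) and a coordinate map `Ψ : 𝒰 → 𝒴 → X` jointly analytic on `𝒪 ×ˢ {‖Y‖ < ε₄′}`, `ε₄ < ε₄′`: ★★ `analyticOnNhd_of_eqOn_comp_solA` —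
  any `sel : 𝒰 → X` that AGREES on `𝒪` with `u ↦ Ψ u (solA (𝒢 u) (Λ u) (W u) (J u) ε₄ (𝔄 u))` (§2's identification, pointwise in `u`) is ANALYTIC on `𝒪` — the shape of the port
  rows' `hBg` ∕ [15] Prop. 9 «analytic function of B, and also of U».

HONEST FRAMING (binding).  A by-name knit: elementary order∕equivalence-relation logic (§1), two PROVED lit theorems applied (§2 Banach uniqueness, §3 analytic dependence), one
`Filter.EventuallyEq` congruence.  NOTHING of [15] is asserted: (cov), (rng), (c→s), (min), (inv), the `Regime` and the data analyticity are DISPLAYED HYPOTHESES — (min)'s global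
half is NOT EVEN PRINTED (cell D-B11-2: the paper proves the local minimum (142) only; `B11GlobalMin` isolates the unprinted convexity lemma).  No lattice object is constructed;
Part II (the record instantiation at `Node00.UkSel ∕ recordBgField`, against DEF-1's P0 (a) names) is NOT in this file; `UkExists ∕ UniqueUkOrbit ∕ hBg` are NOT discharged at the
record by this file; N07 NOT discharged; P0 OPEN; port rows 27930 ∕ 27931 ∕ 26648 OPEN; K0ᴬ ∕ K1ᴬ ∕ K3ᴬ OPEN; COUNT 8∕28 · K 1∕4 UNMOVED; R4 = the CONDITIONAL finite-𝕋⁴ rung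
`BalabanLadder.UV` only — NOT continuum ∕ ℝ⁴ ∕ OS; the Yang–Mills mass gap (Clay) is NOT proved by any of this.
-/

noncomputable section

open Set Metric Filter Topology

namespace Summit.QuantumFields.YangMills.Theorems.N07P0FixedPointIsRecordMinimiser

open Literature.MathematicalPhysics.QuantumFieldTheory.Balaban1983to89
open Literature.MathematicalPhysics.QuantumFieldTheory.Balaban1983to89.B11Prop6Scheme (mapT)
open Literature.MathematicalPhysics.QuantumFieldTheory.Balaban1983to89.B11Eq174Chart (Regime solA)
open Literature.MathematicalPhysics.QuantumFieldTheory.Balaban1983to89.B11Claim309UAnalytic (analyticAt_solA)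

/-! ## §1  The knit — pure logic over the displayed tokens -/

section Knit

variable {Cfg E : Type*} {S : Set Cfg} {𝓐 : Cfg → ℝ} {orb : Cfg → Cfg → Prop} {K : Set E} {Φ : E → Cfg} {IsSol : E → Prop} {Astar : E}

/-- **(rng) + (cov) + (inv) + (min) ⟹ THE MINIMISER-OF-RECORD SHAPE**: the chart image `Φ A⋆` of the distinguished chart point lies in the class-∩-fibre `S` and minimises the
action over ALL of `S` — the two non-trivial clauses of NODE 00's `IsBackground` (the fibre clause is part of `S`).  Proof: a competitor `U ∈ S` is orbit-equivalent to some
chart point `Φ A` (cov), the action is orbit-invariant (inv), and `A⋆` minimises `𝓐 ∘ Φ` on the chart (min).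
[cite: Balaban1985Variational, Thm 1 (8) p.279, pp.280–281, Prop. 3 p.289, (142) p.299; Balaban1987RG1, (0.21) p.256] -/
theorem classMin_of_tokens
    (act_orb : ∀ U U', orb U U' → 𝓐 U = 𝓐 U')
    (range : ∀ A ∈ K, Φ A ∈ S) (covers : ∀ U ∈ S, ∃ A ∈ K, orb (Φ A) U)
    (star_mem : Astar ∈ K) (star_isMinOn : IsMinOn (𝓐 ∘ Φ) K Astar) :
    Φ Astar ∈ S ∧ ∀ U ∈ S, 𝓐 (Φ Astar) ≤ 𝓐 U := by
  refine ⟨range Astar star_mem, fun U hU => ?_⟩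
  obtain ⟨A, hA, hAU⟩ := covers U hU
  rw [← act_orb _ _ hAU]
  exact star_isMinOn hA

/-- **(rng) + (inv) ⟹ a CLASS minimiser's covering chart point is a CHART minimiser**: if `U ∈ S` minimises `𝓐` over `S` and `orb (Φ A) U` with `A ∈ K`, then `A` minimises
`𝓐 ∘ Φ` on `K` (every chart point maps into `S`). [cite: Balaban1985Variational, pp.280–281, (74) p.289] -/
theorem isMinOn_chart_of_isMin_class
    (act_orb : ∀ U U', orb U U' → 𝓐 U = 𝓐 U') (range : ∀ A ∈ K, Φ A ∈ S)
    {U : Cfg} (hmin : ∀ U' ∈ S, 𝓐 U ≤ 𝓐 U') {A : E} (hAU : orb (Φ A) U) :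
    IsMinOn (𝓐 ∘ Φ) K A := by
  intro A' hA'
  have h1 : 𝓐 (Φ A) = 𝓐 U := act_orb _ _ hAU
  show 𝓐 (Φ A) ≤ 𝓐 (Φ A')
  rw [h1]
  exact hmin _ (range A' hA')

/-- **(c→s) + UNIQUENESS OF BALL SOLUTIONS + (min) ⟹ a chart minimiser IS the distinguished point `A⋆`** (both solve the equation in the ball; Prop. 6's uniqueness).
[cite: Balaban1985Variational, Prop. 6 p.295, (111) p.294, Prop. 2 p.281] -/
theorem eq_star_of_isMinOn
    (sol_of_isMinOn : ∀ A ∈ K, IsMinOn (𝓐 ∘ Φ) K A → IsSol A)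
    (sol_unique : ∀ A A', A ∈ K → A' ∈ K → IsSol A → IsSol A' → A = A')
    (star_mem : Astar ∈ K) (star_isMinOn : IsMinOn (𝓐 ∘ Φ) K Astar)
    {A : E} (hA : A ∈ K) (hmin : IsMinOn (𝓐 ∘ Φ) K A) : A = Astar :=
  sol_unique A Astar hA star_mem (sol_of_isMinOn A hA hmin) (sol_of_isMinOn Astar star_mem star_isMinOn)

/-- **★ EVERY CLASS MINIMISER IS RESIDUAL-GAUGE EQUIVALENT TO `Φ A⋆`.** [cite: Balaban1985Variational, Thm 1 p.279 («This orbit is a unique critical orbit in the space (6)»), Prop. 6 p.295] -/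
theorem orb_star_of_isMin
    (act_orb : ∀ U U', orb U U' → 𝓐 U = 𝓐 U') (range : ∀ A ∈ K, Φ A ∈ S) (covers : ∀ U ∈ S, ∃ A ∈ K, orb (Φ A) U)
    (sol_of_isMinOn : ∀ A ∈ K, IsMinOn (𝓐 ∘ Φ) K A → IsSol A)
    (sol_unique : ∀ A A', A ∈ K → A' ∈ K → IsSol A → IsSol A' → A = A')
    (star_mem : Astar ∈ K) (star_isMinOn : IsMinOn (𝓐 ∘ Φ) K Astar)
    {U : Cfg} (hU : U ∈ S) (hmin : ∀ U' ∈ S, 𝓐 U ≤ 𝓐 U') : orb (Φ Astar) U := by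
  obtain ⟨A, hA, hAU⟩ := covers U hU
  have hAmin : IsMinOn (𝓐 ∘ Φ) K A := isMinOn_chart_of_isMin_class act_orb range hmin hAU
  have hAeq : A = Astar := eq_star_of_isMinOn sol_of_isMinOn sol_unique star_mem star_isMinOn hA hAmin
  rw [← hAeq]
  exact hAU

/-- **★★ ANY TWO CLASS MINIMISERS LIE ON ONE RESIDUAL ORBIT** — the shape of NODE 00's `UniqueUkOrbit` (uniqueness among minimisers, cell reading D-n07a-1), from the five tokens,
uniqueness of ball solutions and the equivalence-relation laws of `orb`. [cite: Balaban1985Variational, Thm 1 p.279, Prop. 6 p.295; Balaban1987RG1, (1.1) p.260] -/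
theorem orb_of_isMin_of_isMin
    (orb_symm : ∀ U U', orb U U' → orb U' U) (orb_trans : ∀ U U' U'', orb U U' → orb U' U'' → orb U U'')
    (act_orb : ∀ U U', orb U U' → 𝓐 U = 𝓐 U') (range : ∀ A ∈ K, Φ A ∈ S) (covers : ∀ U ∈ S, ∃ A ∈ K, orb (Φ A) U)
    (sol_of_isMinOn : ∀ A ∈ K, IsMinOn (𝓐 ∘ Φ) K A → IsSol A)
    (sol_unique : ∀ A A', A ∈ K → A' ∈ K → IsSol A → IsSol A' → A = A')
    (star_mem : Astar ∈ K) (star_isMinOn : IsMinOn (𝓐 ∘ Φ) K Astar)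
    {U₁ U₂ : Cfg} (hU₁ : U₁ ∈ S) (hmin₁ : ∀ U' ∈ S, 𝓐 U₁ ≤ 𝓐 U') (hU₂ : U₂ ∈ S) (hmin₂ : ∀ U' ∈ S, 𝓐 U₂ ≤ 𝓐 U') :
    orb U₁ U₂ := by
  have h1 : orb (Φ Astar) U₁ := orb_star_of_isMin act_orb range covers sol_of_isMinOn sol_unique star_mem star_isMinOn hU₁ hmin₁
  have h2 : orb (Φ Astar) U₂ := orb_star_of_isMin act_orb range covers sol_of_isMinOn sol_unique star_mem star_isMinOn hU₂ hmin₂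
  exact orb_trans _ _ _ (orb_symm _ _ h1) h2

/-- **★★ THE SELECTOR IDENTIFICATION** (the law DEF-1's P0 (a) record edition displays for `Node00.UkSel`, here DERIVED): a class minimiser `sel` that is FIXED by a rooted-gauge map
`root` (`root sel = sel`: the selector returns rooted representatives) with `root` CONSTANT ON ORBITS equals `root (Φ A⋆)` — «the rooted gauge of the chart image of the fixed point».
[cite: Balaban1985Variational, Thm 1 p.279; Balaban1987RG1, (0.21) p.256, (1.1) p.260 («We denote by U_k(V) a configuration in the minimal orbit»)] -/
theorem sel_eq_root_chart_star
    (act_orb : ∀ U U', orb U U' → 𝓐 U = 𝓐 U') (range : ∀ A ∈ K, Φ A ∈ S) (covers : ∀ U ∈ S, ∃ A ∈ K, orb (Φ A) U)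
    (sol_of_isMinOn : ∀ A ∈ K, IsMinOn (𝓐 ∘ Φ) K A → IsSol A)
    (sol_unique : ∀ A A', A ∈ K → A' ∈ K → IsSol A → IsSol A' → A = A')
    (star_mem : Astar ∈ K) (star_isMinOn : IsMinOn (𝓐 ∘ Φ) K Astar)
    {root : Cfg → Cfg} (root_orb : ∀ U U', orb U U' → root U = root U')
    {sel : Cfg} (hsel : sel ∈ S) (hselmin : ∀ U' ∈ S, 𝓐 sel ≤ 𝓐 U') (hrooted : root sel = sel) :
    sel = root (Φ Astar) := by
  have h : orb (Φ Astar) sel := orb_star_of_isMin act_orb range covers sol_of_isMinOn sol_unique star_mem star_isMinOn hsel hselmin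
  rw [← hrooted]
  exact (root_orb _ _ h).symm

/-- Converse bookkeeping: under (inv) and `root U` orbit-equivalent to `U`, the identified configuration `root (Φ A⋆)` IS a class minimiser whenever it lies in `S` (class
invariance of `S` under `root` displayed as `hS`) — so the identification loses nothing. [cite: Balaban1987RG1, (0.21) p.256 (bookkeeping)] -/
theorem classMin_root_star
    (act_orb : ∀ U U', orb U U' → 𝓐 U = 𝓐 U') (range : ∀ A ∈ K, Φ A ∈ S) (covers : ∀ U ∈ S, ∃ A ∈ K, orb (Φ A) U)
    (star_mem : Astar ∈ K) (star_isMinOn : IsMinOn (𝓐 ∘ Φ) K Astar)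
    {root : Cfg → Cfg} (root_rel : ∀ U, orb U (root U)) (hS : ∀ U ∈ S, root U ∈ S) :
    root (Φ Astar) ∈ S ∧ ∀ U ∈ S, 𝓐 (root (Φ Astar)) ≤ 𝓐 U := by
  obtain ⟨hmem, hmin⟩ := classMin_of_tokens act_orb range covers star_mem star_isMinOn
  refine ⟨hS _ hmem, fun U hU => ?_⟩
  rw [← act_orb _ _ (root_rel (Φ Astar))]
  exact hmin U hU

end Knit

/-! ## §2  The scheme instance: `E := 𝒴`, «solves in the ball» := `‖A‖ ≤ ε₄ ∧ mapT 𝒢 Λ W J 𝔄 A = A`, `A⋆ := solA …` — Prop. 6 discharges uniqueness and existence -/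

section Scheme

variable {𝒴 𝒵 : Type*} [NormedAddCommGroup 𝒴] [NormedSpace ℂ 𝒴] [CompleteSpace 𝒴] [NormedAddCommGroup 𝒵] [NormedSpace ℂ 𝒵]
variable {𝒢 : 𝒵 →L[ℂ] 𝒴} {Λ : 𝒴 →L[ℂ] 𝒴} {W : 𝒴 → 𝒵} {B₀ θ C₄ a₃ j a ε₄ : ℝ} {J : 𝒵} {𝔄 : 𝒴}

/-- Prop. 6 (PROVED in the tree): `solA` solves the equation in the ball. [cite: Balaban1985Variational, Prop. 6 p.295] -/
theorem isSolBall_solA (R : Regime 𝒢 Λ W B₀ θ C₄ a₃ j a ε₄) (hJ : ‖J‖ ≤ j) (h𝔄 : ‖𝔄‖ < a) :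
    ‖solA 𝒢 Λ W J ε₄ 𝔄‖ ≤ ε₄ ∧ mapT 𝒢 Λ W J 𝔄 (solA 𝒢 Λ W J ε₄ 𝔄) = solA 𝒢 Λ W J ε₄ 𝔄 :=
  R.solA_mem hJ h𝔄

/-- Prop. 6 (PROVED in the tree): ball solutions are unique. [cite: Balaban1985Variational, Prop. 6 p.295] -/
theorem isSolBall_unique (R : Regime 𝒢 Λ W B₀ θ C₄ a₃ j a ε₄) (hJ : ‖J‖ ≤ j) (h𝔄 : ‖𝔄‖ < a) {A A' : 𝒴}
    (hA : ‖A‖ ≤ ε₄ ∧ mapT 𝒢 Λ W J 𝔄 A = A) (hA' : ‖A'‖ ≤ ε₄ ∧ mapT 𝒢 Λ W J 𝔄 A' = A') : A = A' := by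
  rw [R.eq_solA hJ h𝔄 hA.1 hA.2, R.eq_solA hJ h𝔄 hA'.1 hA'.2]

variable {Cfg : Type*} {S : Set Cfg} {𝓐 : Cfg → ℝ} {orb : Cfg → Cfg → Prop} {K : Set 𝒴} {Φ : 𝒴 → Cfg}

omit [CompleteSpace 𝒴] in
/-- **THE MINIMISER-OF-RECORD SHAPE AT THE SCHEME'S FIXED POINT**: (rng)(cov)(inv) + «`solA` lies in the chart and minimises `𝓐 ∘ Φ` on it» ((115) ⊆ K; (142) + the located global
step) ⟹ `Φ (solA …) ∈ S` and it minimises the action over `S`. [cite: Balaban1985Variational, Thm 1 (8) p.279, Prop. 6 p.295, (142) p.299] -/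
theorem classMin_solA_of_tokens
    (act_orb : ∀ U U', orb U U' → 𝓐 U = 𝓐 U') (range : ∀ A ∈ K, Φ A ∈ S) (covers : ∀ U ∈ S, ∃ A ∈ K, orb (Φ A) U)
    (star_mem : solA 𝒢 Λ W J ε₄ 𝔄 ∈ K) (star_isMinOn : IsMinOn (𝓐 ∘ Φ) K (solA 𝒢 Λ W J ε₄ 𝔄)) :
    Φ (solA 𝒢 Λ W J ε₄ 𝔄) ∈ S ∧ ∀ U ∈ S, 𝓐 (Φ (solA 𝒢 Λ W J ε₄ 𝔄)) ≤ 𝓐 U :=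
  classMin_of_tokens act_orb range covers star_mem star_isMinOn

/-- **★★ UNIQUENESS OF THE MINIMAL ORBIT AT THE SCHEME** — `UniqueUkOrbit`'s shape with Prop. 6's uniqueness DISCHARGED: displayed remain (inv), (rng), (cov), (c→s) («a chart
minimiser solves (116) in the ball (115)»), and (min) for `solA`. [cite: Balaban1985Variational, Thm 1 p.279, Prop. 6 p.295, (111) p.294, Prop. 2 p.281, (142) p.299] -/
theorem orb_of_isMin_of_isMin_scheme (R : Regime 𝒢 Λ W B₀ θ C₄ a₃ j a ε₄) (hJ : ‖J‖ ≤ j) (h𝔄 : ‖𝔄‖ < a)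
    (orb_symm : ∀ U U', orb U U' → orb U' U) (orb_trans : ∀ U U' U'', orb U U' → orb U' U'' → orb U U'')
    (act_orb : ∀ U U', orb U U' → 𝓐 U = 𝓐 U') (range : ∀ A ∈ K, Φ A ∈ S) (covers : ∀ U ∈ S, ∃ A ∈ K, orb (Φ A) U)
    (sol_of_isMinOn : ∀ A ∈ K, IsMinOn (𝓐 ∘ Φ) K A → ‖A‖ ≤ ε₄ ∧ mapT 𝒢 Λ W J 𝔄 A = A)
    (star_mem : solA 𝒢 Λ W J ε₄ 𝔄 ∈ K) (star_isMinOn : IsMinOn (𝓐 ∘ Φ) K (solA 𝒢 Λ W J ε₄ 𝔄))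
    {U₁ U₂ : Cfg} (hU₁ : U₁ ∈ S) (hmin₁ : ∀ U' ∈ S, 𝓐 U₁ ≤ 𝓐 U') (hU₂ : U₂ ∈ S) (hmin₂ : ∀ U' ∈ S, 𝓐 U₂ ≤ 𝓐 U') :
    orb U₁ U₂ :=
  orb_of_isMin_of_isMin (IsSol := fun A => ‖A‖ ≤ ε₄ ∧ mapT 𝒢 Λ W J 𝔄 A = A) orb_symm orb_trans act_orb range covers sol_of_isMinOn
    (fun _ _ _ _ hA hA' => isSolBall_unique R hJ h𝔄 hA hA') star_mem star_isMinOn hU₁ hmin₁ hU₂ hmin₂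

/-- **★★ THE SELECTOR IDENTIFICATION AT THE SCHEME**: a rooted class minimiser EQUALS `root (Φ (solA 𝒢 Λ W J ε₄ 𝔄))` — the NAMED MAP «U_k = rooted gauge ∘ chart ∘ (Prop. 6's
solution)» of №509 (A), as an EQUATION about any selector with the minimiser property (NODE 00's `UkSel` at the record, Part II).
[cite: Balaban1985Variational, Thm 1 p.279, Prop. 6 p.295, (174) p.305; Balaban1987RG1, (1.1) p.260] -/
theorem sel_eq_root_chart_solA (R : Regime 𝒢 Λ W B₀ θ C₄ a₃ j a ε₄) (hJ : ‖J‖ ≤ j) (h𝔄 : ‖𝔄‖ < a)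
    (act_orb : ∀ U U', orb U U' → 𝓐 U = 𝓐 U') (range : ∀ A ∈ K, Φ A ∈ S) (covers : ∀ U ∈ S, ∃ A ∈ K, orb (Φ A) U)
    (sol_of_isMinOn : ∀ A ∈ K, IsMinOn (𝓐 ∘ Φ) K A → ‖A‖ ≤ ε₄ ∧ mapT 𝒢 Λ W J 𝔄 A = A)
    (star_mem : solA 𝒢 Λ W J ε₄ 𝔄 ∈ K) (star_isMinOn : IsMinOn (𝓐 ∘ Φ) K (solA 𝒢 Λ W J ε₄ 𝔄))
    {root : Cfg → Cfg} (root_orb : ∀ U U', orb U U' → root U = root U')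
    {sel : Cfg} (hsel : sel ∈ S) (hselmin : ∀ U' ∈ S, 𝓐 sel ≤ 𝓐 U') (hrooted : root sel = sel) :
    sel = root (Φ (solA 𝒢 Λ W J ε₄ 𝔄)) :=
  sel_eq_root_chart_star (IsSol := fun A => ‖A‖ ≤ ε₄ ∧ mapT 𝒢 Λ W J 𝔄 A = A) act_orb range covers sol_of_isMinOn
    (fun _ _ _ _ hA hA' => isSolBall_unique R hJ h𝔄 hA hA') star_mem star_isMinOn root_orb hsel hselmin hrooted

end Scheme

/-! ## §3  Analyticity of the identified selector in the chart variables ([15] Prop. 9 «analytic function of B, and also of U»; the port rows' `hBg` shape) -/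

section Analytic

variable {𝒰 𝒴 𝒵 X : Type*} [NormedAddCommGroup 𝒰] [NormedSpace ℂ 𝒰] [CompleteSpace 𝒰] [NormedAddCommGroup 𝒴] [NormedSpace ℂ 𝒴] [CompleteSpace 𝒴]
  [NormedAddCommGroup 𝒵] [NormedSpace ℂ 𝒵] [CompleteSpace 𝒵] [NormedAddCommGroup X] [NormedSpace ℂ X]
variable {𝒪 : Set 𝒰} {𝒢 : 𝒰 → (𝒵 →L[ℂ] 𝒴)} {Λ : 𝒰 → (𝒴 →L[ℂ] 𝒴)} {W : 𝒰 → 𝒴 → 𝒵} {J : 𝒰 → 𝒵} {𝔄 : 𝒰 → 𝒴}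
  {B₀ θ C₄ a₃ j a ε₄ : ℝ}

/-- **★★ A SELECTOR THAT AGREES WITH «coordinates ∘ (Prop. 6's solution)» IS ANALYTIC IN THE PARAMETER.**  Data `𝒢, Λ, W, J, 𝔄` analytic on an open `𝒪` under a uniform `Regime`
(`B11Claim309UAnalytic` §2's hypotheses, verbatim), a coordinate map `Ψ : 𝒰 → 𝒴 → X` jointly analytic on `𝒪 ×ˢ {‖Y‖ < ε₄′}` with `ε₄ < ε₄′`; then ANY `sel : 𝒰 → X` with
`sel u = Ψ u (solA (𝒢 u) (Λ u) (W u) (J u) ε₄ (𝔄 u))` for `u ∈ 𝒪` (§2's identification, pointwise) is `AnalyticOnNhd ℂ sel 𝒪` — by `analyticAt_solA` (the fixed point of a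
uniformly contracting analytic family is analytic) + composition + `𝒪`-local agreement. [cite: Balaban1985Variational, Prop. 9 p.309, p.296 (proof of Prop. 6, last clause), (174) p.305] -/
theorem analyticOnNhd_of_eqOn_comp_solA (h𝒪 : IsOpen 𝒪) (R : ∀ u ∈ 𝒪, Regime (𝒢 u) (Λ u) (W u) B₀ θ C₄ a₃ j a ε₄)
    (hJb : ∀ u ∈ 𝒪, ‖J u‖ ≤ j) (h𝔄b : ∀ u ∈ 𝒪, ‖𝔄 u‖ < a)
    (h𝒢 : AnalyticOnNhd ℂ 𝒢 𝒪) (hΛ : AnalyticOnNhd ℂ Λ 𝒪)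
    (hW : AnalyticOnNhd ℂ (fun p : 𝒰 × 𝒴 => W p.1 p.2) (𝒪 ×ˢ {Y : 𝒴 | ‖Y‖ < a₃})) (hJ : AnalyticOnNhd ℂ J 𝒪)
    (h𝔄 : AnalyticOnNhd ℂ 𝔄 𝒪) {ε₄' : ℝ} (hε : ε₄ < ε₄') {Ψ : 𝒰 → 𝒴 → X}
    (hΨ : AnalyticOnNhd ℂ (fun p : 𝒰 × 𝒴 => Ψ p.1 p.2) (𝒪 ×ˢ {Y : 𝒴 | ‖Y‖ < ε₄'}))
    {sel : 𝒰 → X} (hsel : ∀ u ∈ 𝒪, sel u = Ψ u (solA (𝒢 u) (Λ u) (W u) (J u) ε₄ (𝔄 u))) :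
    AnalyticOnNhd ℂ sel 𝒪 := by
  intro u₀ hu₀
  have hsol := analyticAt_solA h𝒪 R hJb h𝔄b h𝒢 hΛ hW hJ h𝔄 hu₀
  have hin : AnalyticAt ℂ (fun u : 𝒰 => (u, solA (𝒢 u) (Λ u) (W u) (J u) ε₄ (𝔄 u))) u₀ := analyticAt_id.prod hsol
  have hmem : ‖solA (𝒢 u₀) (Λ u₀) (W u₀) (J u₀) ε₄ (𝔄 u₀)‖ < ε₄' :=
    lt_of_le_of_lt ((R u₀ hu₀).solA_mem (hJb u₀ hu₀) (h𝔄b u₀ hu₀)).1 hε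
  have hΨ₀ : AnalyticAt ℂ (fun p : 𝒰 × 𝒴 => Ψ p.1 p.2) (u₀, solA (𝒢 u₀) (Λ u₀) (W u₀) (J u₀) ε₄ (𝔄 u₀)) := hΨ _ ⟨hu₀, hmem⟩
  have hcomp : AnalyticAt ℂ (fun u : 𝒰 => Ψ u (solA (𝒢 u) (Λ u) (W u) (J u) ε₄ (𝔄 u))) u₀ := by
    have h := AnalyticAt.comp_of_eq hΨ₀ hin rfl
    simpa [Function.comp_def] using h
  refine hcomp.congr ?_
  filter_upwards [h𝒪.mem_nhds hu₀] with u hu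
  exact (hsel u hu).symm

end Analytic

/-! ## §4  At NODE 00's objects, chart abstract: `IsBackground`, `UkExists`, `UniqueUkOrbit`, `UkSel = rootGauge ∘ Φ (A⋆)` LITERALLY, from the five tokens -/

section Record

open Literature.MathematicalPhysics.QuantumFieldTheory.Balaban1983to89.Node00
open Literature.MathematicalPhysics.QuantumFieldTheory.Balaban1983to89.T4Continuum (T4Family)
open Literature.MathematicalPhysics.QuantumFieldTheory.Balaban1983to89.B12GaugeOrbits021 (OrbitRel wilsonAction4_eq_of_orbitRel)
open Literature.MathematicalPhysics.QuantumFieldTheory.Balaban1983to89.T4RootedResidualGauge (rootGauge rootGauge_eq_of_orbitRel)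

variable {F : T4Family} {N : ℕ} [NeZero N] {K k : ℕ} {ε : ℝ} {V : GaugeField (F.P K) k (SU N)}
variable {E : Type*} {Kc : Set E} {Φ : E → GaugeField (F.P K) 0 (SU N)} {IsSol : E → Prop} {Astar : E}

/-- **★★ THE FIVE TOKENS ⟹ `IsBackground` OF THE CHART IMAGE OF THE DISTINGUISHED POINT, LITERALLY** (NODE 00's minimiser-of-record predicate over the class `bgReg F N K k ε`
and the fibre `Ū^k = V`): (rng) = chart points are plaquette-regular and average to `V`; (cov) = every regular configuration averaging to `V` is residual-gauge equivalent to a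
chart point; (min) = `A⋆` minimises `wilsonAction4 ∘ Φ` on the chart; (inv) is the tree's `wilsonAction4_eq_of_orbitRel`.
[cite: Balaban1985Variational, Thm 1 (8) p.279, pp.280–281, Prop. 3 p.289, (142) p.299; Balaban1987RG1, (0.21) p.256, (1.1)–(1.2) p.260] -/
theorem isBackground_chart_of_tokens
    (range : ∀ A ∈ Kc, Φ A ∈ bgReg F N K k ε ∧ Averaging.iter (avOfRecord F N K) k (Φ A) = V)
    (covers : ∀ U : GaugeField (F.P K) 0 (SU N), U ∈ bgReg F N K k ε → Averaging.iter (avOfRecord F N K) k U = V → ∃ A ∈ Kc, OrbitRel k (Φ A) U)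
    (star_mem : Astar ∈ Kc) (star_isMinOn : IsMinOn (wilsonAction4 ∘ Φ) Kc Astar) :
    IsBackground (avOfRecord F N K) (bgReg F N K k ε) k V (Φ Astar) := by
  have h := classMin_of_tokens (S := {U : GaugeField (F.P K) 0 (SU N) | U ∈ bgReg F N K k ε ∧ Averaging.iter (avOfRecord F N K) k U = V})
    (𝓐 := wilsonAction4) (orb := OrbitRel k) (K := Kc) (Φ := Φ) (Astar := Astar)
    (fun U U' hUU' => (wilsonAction4_eq_of_orbitRel hUU').symm) (fun A hA => range A hA) (fun U hU => covers U hU.1 hU.2) star_mem star_isMinOn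
  exact ⟨h.1.2, h.1.1, fun U hU hUV => h.2 U ⟨hU, hUV⟩⟩

/-- Hence `UkExists F N K k ε V` (the port rows' `hUk`, first conjunct, at THIS `V`). [cite: Balaban1985Variational, Thm 1 (8) p.279; Balaban1987RG1, (1.1) p.260] -/
theorem ukExists_chart_of_tokens
    (range : ∀ A ∈ Kc, Φ A ∈ bgReg F N K k ε ∧ Averaging.iter (avOfRecord F N K) k (Φ A) = V)
    (covers : ∀ U : GaugeField (F.P K) 0 (SU N), U ∈ bgReg F N K k ε → Averaging.iter (avOfRecord F N K) k U = V → ∃ A ∈ Kc, OrbitRel k (Φ A) U)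
    (star_mem : Astar ∈ Kc) (star_isMinOn : IsMinOn (wilsonAction4 ∘ Φ) Kc Astar) :
    UkExists F N K k ε V :=
  ⟨Φ Astar, isBackground_chart_of_tokens range covers star_mem star_isMinOn⟩

/-- **★★★ THE FIVE TOKENS + UNIQUENESS OF BALL SOLUTIONS ⟹ `UniqueUkOrbit F N K k ε V`, LITERALLY** (the port rows' `hUk`, second conjunct; road B's (H-U) premise; [I] (1.1)
«exactly one regular, critical orbit» in NODE 00's reading).  (c→s) = «a chart minimiser solves [15] (111)∕(116) in the ball (115)».
[cite: Balaban1985Variational, Thm 1 p.279 («This orbit is a unique critical orbit in the space (6)»), Prop. 6 p.295, Prop. 2 p.281; Balaban1987RG1, (1.1) p.260] -/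
theorem uniqueUkOrbit_chart_of_tokens
    (range : ∀ A ∈ Kc, Φ A ∈ bgReg F N K k ε ∧ Averaging.iter (avOfRecord F N K) k (Φ A) = V)
    (covers : ∀ U : GaugeField (F.P K) 0 (SU N), U ∈ bgReg F N K k ε → Averaging.iter (avOfRecord F N K) k U = V → ∃ A ∈ Kc, OrbitRel k (Φ A) U)
    (sol_of_isMinOn : ∀ A ∈ Kc, IsMinOn (wilsonAction4 ∘ Φ) Kc A → IsSol A)
    (sol_unique : ∀ A A', A ∈ Kc → A' ∈ Kc → IsSol A → IsSol A' → A = A')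
    (star_mem : Astar ∈ Kc) (star_isMinOn : IsMinOn (wilsonAction4 ∘ Φ) Kc Astar) :
    UniqueUkOrbit F N K k ε V := by
  intro U₀ U₀' h₀ h₀'
  exact orb_of_isMin_of_isMin (S := {U : GaugeField (F.P K) 0 (SU N) | U ∈ bgReg F N K k ε ∧ Averaging.iter (avOfRecord F N K) k U = V})
    (𝓐 := wilsonAction4) (orb := OrbitRel k) (K := Kc) (Φ := Φ) (IsSol := IsSol) (Astar := Astar)
    (fun U U' h => h.symm) (fun U U' U'' h h' => h.trans h') (fun U U' hUU' => (wilsonAction4_eq_of_orbitRel hUU').symm)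
    (fun A hA => range A hA) (fun U hU => covers U hU.1 hU.2) sol_of_isMinOn sol_unique star_mem star_isMinOn
    ⟨h₀.2.1, h₀.1⟩ (fun U' hU' => h₀.2.2 U' hU'.1 hU'.2) ⟨h₀'.2.1, h₀'.1⟩ (fun U' hU' => h₀'.2.2 U' hU'.1 hU'.2)

/-- **★★★ №509 (A)'s NAMED MAP AS AN EQUATION**: `UkSel F N K k ε V = rootGauge k (Φ A⋆)` — NODE 00's measurable rooted selector IS the rooted gauge of the chart image of the
distinguished chart point, from the five tokens + uniqueness of ball solutions (standing range `k ≤ m + K`; by `Node00.rootGauge_eq_UkSel_of_isBackground`).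
[cite: Balaban1985Variational, Thm 1 p.279, (174) p.305; Balaban1987RG1, (1.1) p.260 («We denote by U_k(V) a configuration in the minimal orbit»), (2.3) p.265] -/
theorem ukSel_eq_rootGauge_chart_of_tokens (hk : k ≤ (F.P K).m + (F.P K).K)
    (range : ∀ A ∈ Kc, Φ A ∈ bgReg F N K k ε ∧ Averaging.iter (avOfRecord F N K) k (Φ A) = V)
    (covers : ∀ U : GaugeField (F.P K) 0 (SU N), U ∈ bgReg F N K k ε → Averaging.iter (avOfRecord F N K) k U = V → ∃ A ∈ Kc, OrbitRel k (Φ A) U)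
    (sol_of_isMinOn : ∀ A ∈ Kc, IsMinOn (wilsonAction4 ∘ Φ) Kc A → IsSol A)
    (sol_unique : ∀ A A', A ∈ Kc → A' ∈ Kc → IsSol A → IsSol A' → A = A')
    (star_mem : Astar ∈ Kc) (star_isMinOn : IsMinOn (wilsonAction4 ∘ Φ) Kc Astar) :
    UkSel F N K k ε V = rootGauge k (Φ Astar) :=
  (rootGauge_eq_UkSel_of_isBackground hk (uniqueUkOrbit_chart_of_tokens range covers sol_of_isMinOn sol_unique star_mem star_isMinOn)
    (isBackground_chart_of_tokens range covers star_mem star_isMinOn)).symm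

variable {𝒴 𝒵 : Type*} [NormedAddCommGroup 𝒴] [NormedSpace ℂ 𝒴] [CompleteSpace 𝒴] [NormedAddCommGroup 𝒵] [NormedSpace ℂ 𝒵]
variable {𝒢 : 𝒵 →L[ℂ] 𝒴} {Λ : 𝒴 →L[ℂ] 𝒴} {W : 𝒴 → 𝒵} {B₀ θ C₄ a₃ j a ε₄ : ℝ} {J : 𝒵} {𝔄 : 𝒴} {Kc' : Set 𝒴} {Φ' : 𝒴 → GaugeField (F.P K) 0 (SU N)}

/-- **★★★ `UniqueUkOrbit` AT THE SCHEME**: the chart space IS [15]'s `𝒴`, «solves in the ball» IS `‖A‖ ≤ ε₄ ∧ mapT 𝒢 Λ W J 𝔄 A = A`, the distinguished point IS `solA …`, and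
Prop. 6's uniqueness is DISCHARGED by the `Regime` — ONLY (rng)(cov)(c→s)(min) displayed. [cite: Balaban1985Variational, Thm 1 p.279, Prop. 6 (117)–(121) p.295, Prop. 2 p.281, (142) p.299] -/
theorem uniqueUkOrbit_chart_of_scheme (R : Regime 𝒢 Λ W B₀ θ C₄ a₃ j a ε₄) (hJ : ‖J‖ ≤ j) (h𝔄 : ‖𝔄‖ < a)
    (range : ∀ A ∈ Kc', Φ' A ∈ bgReg F N K k ε ∧ Averaging.iter (avOfRecord F N K) k (Φ' A) = V)
    (covers : ∀ U : GaugeField (F.P K) 0 (SU N), U ∈ bgReg F N K k ε → Averaging.iter (avOfRecord F N K) k U = V → ∃ A ∈ Kc', OrbitRel k (Φ' A) U)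
    (sol_of_isMinOn : ∀ A ∈ Kc', IsMinOn (wilsonAction4 ∘ Φ') Kc' A → ‖A‖ ≤ ε₄ ∧ mapT 𝒢 Λ W J 𝔄 A = A)
    (star_mem : solA 𝒢 Λ W J ε₄ 𝔄 ∈ Kc') (star_isMinOn : IsMinOn (wilsonAction4 ∘ Φ') Kc' (solA 𝒢 Λ W J ε₄ 𝔄)) :
    UniqueUkOrbit F N K k ε V :=
  uniqueUkOrbit_chart_of_tokens (IsSol := fun A => ‖A‖ ≤ ε₄ ∧ mapT 𝒢 Λ W J 𝔄 A = A) range covers sol_of_isMinOn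
    (fun _ _ _ _ hA hA' => isSolBall_unique R hJ h𝔄 hA hA') star_mem star_isMinOn

/-- **★★★ THE NAMED MAP AT THE SCHEME**: `UkSel F N K k ε V = rootGauge k (Φ′ (solA 𝒢 Λ W J ε₄ 𝔄))` — «U_k of record = rooted gauge ∘ chart ∘ Prop. 6's solution», with Prop. 6 discharged.
[cite: Balaban1985Variational, Thm 1 p.279, Prop. 6 p.295, (174) p.305; Balaban1987RG1, (1.1) p.260, (2.3) p.265] -/
theorem ukSel_eq_rootGauge_chart_solA (hk : k ≤ (F.P K).m + (F.P K).K) (R : Regime 𝒢 Λ W B₀ θ C₄ a₃ j a ε₄) (hJ : ‖J‖ ≤ j) (h𝔄 : ‖𝔄‖ < a)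
    (range : ∀ A ∈ Kc', Φ' A ∈ bgReg F N K k ε ∧ Averaging.iter (avOfRecord F N K) k (Φ' A) = V)
    (covers : ∀ U : GaugeField (F.P K) 0 (SU N), U ∈ bgReg F N K k ε → Averaging.iter (avOfRecord F N K) k U = V → ∃ A ∈ Kc', OrbitRel k (Φ' A) U)
    (sol_of_isMinOn : ∀ A ∈ Kc', IsMinOn (wilsonAction4 ∘ Φ') Kc' A → ‖A‖ ≤ ε₄ ∧ mapT 𝒢 Λ W J 𝔄 A = A)
    (star_mem : solA 𝒢 Λ W J ε₄ 𝔄 ∈ Kc') (star_isMinOn : IsMinOn (wilsonAction4 ∘ Φ') Kc' (solA 𝒢 Λ W J ε₄ 𝔄)) :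
    UkSel F N K k ε V = rootGauge k (Φ' (solA 𝒢 Λ W J ε₄ 𝔄)) :=
  ukSel_eq_rootGauge_chart_of_tokens (IsSol := fun A => ‖A‖ ≤ ε₄ ∧ mapT 𝒢 Λ W J 𝔄 A = A) hk range covers sol_of_isMinOn
    (fun _ _ _ _ hA hA' => isSolBall_unique R hJ h𝔄 hA hA') star_mem star_isMinOn

end Record

end Summit.QuantumFields.YangMills.Theorems.N07P0FixedPointIsRecordMinimiser

end
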